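import Summits.Ventures.Crystal3D.Theorems.StickyWulffConstantGenericWallFloorChainLedgerSealed
import Summits.Ventures.Crystal3D.Theorems.StickyWulffConstantGenericWallFloorGeneralRungNotCoaxial
import HarnessLib

/-!
# `DoubleStarCoaxialAt`: the CORRECT named input for the tilted double tops (conclusion CO-AXIAL), and the
# sealed chain ledger modulo it, with the crux's non-co-axiality hypothesis verbatim

HONEST FRAMING. Part of the venture `Summits/Ventures/Crystal3D` (cell `crystal3d-full`), helper
`--supports` the crux `GenericWallFloor` (stmt-Ventures-19480) of `route-Ventures-StickyWulffConstant`,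
registered line `WallLedgerG`, open stub `stub_twoSlabAdhesion`.  CORRECTION of `…DoubleStar`
(`DoubleStarFree`, p583112): as wulff-p2 g9 observed (INBOX 2026-08-27 23:05Z), with the hypothesis
«linear lattices different» the statement `DoubleStarFree` is FALSE — at the exact Σ3-TWIN double top
(co-axial but `A₁·Λ₀ ≠ A₂·Λ₀`) the two predecessor dozens form a packing and a free twin-plane slot takes an
eleventh ball.  The input the chain ledger really needs concludes CO-AXIALITY, which the crux excludes by
its own hypothesis.  This file states it in the cluster form wulff-p2 asked for (their local joint-rigidity
lemmas `…DoubleTopLocal*` and eng/cf-p2's interval B&B R39d are to discharge it literally):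

* `DoubleStarCoaxialAt A₁ A₂` (Prop, per pair of frames): slots `u₁, u₂` (no steepness), a `1`-separated `X`
  containing `e`, the two predecessors `e − Aᵢ uᵢ` with their full slot shells (two 13-ball clusters), and
  an eleventh ball `y ∈ X` at distance `1` from `e` off the ten star balls `e + Aᵢ w` (`⟪w, uᵢ⟫ < 0`)
  ⇒ the LINEAR lattices `A₁·Λ₀`, `A₂·Λ₀` are co-axial (common Barlow frame).
* `coaxial_affine_of_linear` — linear co-axiality gives the crux's affine co-axiality for all `t₁, t₂`.
* `dt11_card_eq_zero_of_doubleStarCoaxial` — under `DoubleStarCoaxialAt A₁ A₂` and the crux's hypothesis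
  `¬ CoAx`, the degree-11 coincidence double-top set `DT₁₁` of the chain ledger is empty.
* **`twoSlabAdhesion_sealed_of_doubleStarCoaxial`** — the sealed chain ledger with the crux's
  non-co-axiality hypothesis VERBATIM (slot-set hypotheses derived by `slots_not_subset_of_not_coaxial`):
  `cross(P₁,X∖P₁) + cross(P₂,Y) ≤ D(Y) + (φ₁+φ₂ − ½(κ₁+κ₂))πρ² + ½(#TC₁+#TC₂) + C(1+h)ρ` for every steep
  slot pair, inputs `ExactOnly`(C12-55) and `DoubleStarCoaxialAt A₁ A₂`.

WHAT THIS IS NOT: `DoubleStarCoaxialAt` is an INPUT (certificate R39d / wulff-p2's local lemmas pending);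
not the stub; F-C1 not moved.
-/

noncomputable section

namespace Summit.Ventures.Crystal3D.Theorems

open Summit.Ventures.Crystal3D Finset
open Literature.MathematicalPhysics.StatisticalMechanics (fccStacking barlowStacking IsHaggSeq contactDeficiency)
open scoped InnerProductSpace

/-- **`DoubleStarCoaxialAt A₁ A₂`** (geometric input of the chain ledger; census kit j292323 and wulff-p2 g9's
full-dozen census; certificate R39d pending).  In a `1`-separated configuration `X`: if `e ∈ X` has a
FULL-shell `A₁ u₁`-predecessor and a FULL-shell `A₂ u₂`-predecessor (two 13-ball clusters through `e`) and
an eleventh neighbour `y` off the ten star balls `e + Aᵢ w`, `⟪w, uᵢ⟫ < 0`, then the linear lattices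
`A₁·Λ₀` and `A₂·Λ₀` lie in a common Barlow frame (are co-axial). -/
def DoubleStarCoaxialAt (A₁ A₂ : EuclideanSpace ℝ (Fin 3) ≃ₗᵢ[ℝ] EuclideanSpace ℝ (Fin 3)) : Prop :=
    ∀ u₁ ∈ fccSlots, ∀ u₂ ∈ fccSlots, ∀ (X : Finset (EuclideanSpace ℝ (Fin 3))),
      (∀ p ∈ X, ∀ q ∈ X, p ≠ q → 1 ≤ dist p q) →
      ∀ e ∈ X, e - A₁ u₁ ∈ X → (∀ w ∈ fccSlots, e - A₁ u₁ + A₁ w ∈ X) →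
        e - A₂ u₂ ∈ X → (∀ w ∈ fccSlots, e - A₂ u₂ + A₂ w ∈ X) →
        ∀ y ∈ X, dist e y = 1 →
          (∀ w ∈ fccSlots, ⟪w, u₁⟫_ℝ < 0 → y ≠ e + A₁ w) → (∀ w ∈ fccSlots, ⟪w, u₂⟫_ℝ < 0 → y ≠ e + A₂ w) →
          ∃ (L : EuclideanSpace ℝ (Fin 3) ≃ₗᵢ[ℝ] EuclideanSpace ℝ (Fin 3))
            (s₁ s₂ : EuclideanSpace ℝ (Fin 3)) (σ σ' : ℤ → ℤ), IsHaggSeq σ ∧ IsHaggSeq σ' ∧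
            A₁ '' fccStacking 1 (Real.sqrt (2 / 3)) ⊆
              (fun p => L p + s₁) '' barlowStacking 1 (Real.sqrt (2 / 3)) σ ∧
            A₂ '' fccStacking 1 (Real.sqrt (2 / 3)) ⊆
              (fun p => L p + s₂) '' barlowStacking 1 (Real.sqrt (2 / 3)) σ'

/-- Linear co-axiality gives the crux's (affine) co-axiality for every pair of translates. -/
theorem coaxial_affine_of_linear (A₁ A₂ : EuclideanSpace ℝ (Fin 3) ≃ₗᵢ[ℝ] EuclideanSpace ℝ (Fin 3))
    (t₁ t₂ : EuclideanSpace ℝ (Fin 3))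
    (h : ∃ (L : EuclideanSpace ℝ (Fin 3) ≃ₗᵢ[ℝ] EuclideanSpace ℝ (Fin 3))
      (s₁ s₂ : EuclideanSpace ℝ (Fin 3)) (σ σ' : ℤ → ℤ), IsHaggSeq σ ∧ IsHaggSeq σ' ∧
      A₁ '' fccStacking 1 (Real.sqrt (2 / 3)) ⊆ (fun p => L p + s₁) '' barlowStacking 1 (Real.sqrt (2 / 3)) σ ∧
      A₂ '' fccStacking 1 (Real.sqrt (2 / 3)) ⊆ (fun p => L p + s₂) '' barlowStacking 1 (Real.sqrt (2 / 3)) σ') :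
    ∃ (L : EuclideanSpace ℝ (Fin 3) ≃ₗᵢ[ℝ] EuclideanSpace ℝ (Fin 3))
      (s₁ s₂ : EuclideanSpace ℝ (Fin 3)) (σ σ' : ℤ → ℤ), IsHaggSeq σ ∧ IsHaggSeq σ' ∧
      (fun p => A₁ p + t₁) '' fccStacking 1 (Real.sqrt (2 / 3)) ⊆
        (fun p => L p + s₁) '' barlowStacking 1 (Real.sqrt (2 / 3)) σ ∧
      (fun p => A₂ p + t₂) '' fccStacking 1 (Real.sqrt (2 / 3)) ⊆
        (fun p => L p + s₂) '' barlowStacking 1 (Real.sqrt (2 / 3)) σ' := by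
  obtain ⟨L, s₁, s₂, σ, σ', hσ, hσ', h₁, h₂⟩ := h
  refine ⟨L, s₁ + t₁, s₂ + t₂, σ, σ', hσ, hσ', ?_, ?_⟩
  · rintro _ ⟨p, hp, rfl⟩
    obtain ⟨b, hb, hbe⟩ := h₁ ⟨p, hp, rfl⟩
    exact ⟨b, hb, by simp only at hbe ⊢; rw [← add_assoc, hbe]⟩
  · rintro _ ⟨p, hp, rfl⟩
    obtain ⟨b, hb, hbe⟩ := h₂ ⟨p, hp, rfl⟩
    exact ⟨b, hb, by simp only at hbe ⊢; rw [← add_assoc, hbe]⟩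

/-- The ten star balls of a double top: at most ten of them. -/
theorem card_starBalls_le_ten (A₁ A₂ : EuclideanSpace ℝ (Fin 3) ≃ₗᵢ[ℝ] EuclideanSpace ℝ (Fin 3))
    {u₁ u₂ : EuclideanSpace ℝ (Fin 3)} (hu₁ : u₁ ∈ fccSlots) (hu₂ : u₂ ∈ fccSlots) (e : EuclideanSpace ℝ (Fin 3)) :
    (((fccSlots.filter fun w => 0 < ⟪w, -u₁⟫_ℝ).image fun w => e + A₁ w) ∪
      ((fccSlots.filter fun w => 0 < ⟪w, -u₂⟫_ℝ).image fun w => e + A₂ w)).card ≤ 10 := by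
  classical
  calc _ ≤ ((fccSlots.filter fun w => 0 < ⟪w, -u₁⟫_ℝ).image fun w => e + A₁ w).card +
        ((fccSlots.filter fun w => 0 < ⟪w, -u₂⟫_ℝ).image fun w => e + A₂ w).card := card_union_le _ _
    _ ≤ 5 + 5 := Nat.add_le_add
        (card_image_le.trans (card_star_eq_five (neg_mem_fccSlots hu₁)).le)
        (card_image_le.trans (card_star_eq_five (neg_mem_fccSlots hu₂)).le)
    _ = 10 := by norm_num

open scoped Classical in
/-- **Under `DoubleStarCoaxialAt` and non-co-axiality the degree-11 double tops do not exist.** -/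
theorem dt11_card_eq_zero_of_doubleStarCoaxial
    (A₁ A₂ : EuclideanSpace ℝ (Fin 3) ≃ₗᵢ[ℝ] EuclideanSpace ℝ (Fin 3)) (hDS : DoubleStarCoaxialAt A₁ A₂)
    (t₁ t₂ : EuclideanSpace ℝ (Fin 3))
    (hnc : ¬ ∃ (L : EuclideanSpace ℝ (Fin 3) ≃ₗᵢ[ℝ] EuclideanSpace ℝ (Fin 3))
        (s₁ s₂ : EuclideanSpace ℝ (Fin 3)) (σ σ' : ℤ → ℤ), IsHaggSeq σ ∧ IsHaggSeq σ' ∧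
        (fun p => A₁ p + t₁) '' fccStacking 1 (Real.sqrt (2 / 3)) ⊆
          (fun p => L p + s₁) '' barlowStacking 1 (Real.sqrt (2 / 3)) σ ∧
        (fun p => A₂ p + t₂) '' fccStacking 1 (Real.sqrt (2 / 3)) ⊆
          (fun p => L p + s₂) '' barlowStacking 1 (Real.sqrt (2 / 3)) σ')
    {u₁ u₂ : EuclideanSpace ℝ (Fin 3)} (hu₁ : u₁ ∈ fccSlots) (hu₂ : u₂ ∈ fccSlots)
    {X : Finset (EuclideanSpace ℝ (Fin 3))} (hX : ∀ p ∈ X, ∀ q ∈ X, p ≠ q → 1 ≤ dist p q) :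
    (X.filter fun e => e ∈ (fun q => A₁ q + t₁) '' fccStacking 1 (Real.sqrt (2 / 3)) ∧
      e ∈ (fun q => A₂ q + t₂) '' fccStacking 1 (Real.sqrt (2 / 3)) ∧
      (X.filter fun q => dist e q = 1).card = 11 ∧
      (e - A₁ u₁ ∈ X ∧ (∀ w ∈ fccSlots, e - A₁ u₁ + A₁ w ∈ X) ∧ ∃ v ∈ fccSlots, e + A₁ v ∉ X) ∧
      (e - A₂ u₂ ∈ X ∧ (∀ w ∈ fccSlots, e - A₂ u₂ + A₂ w ∈ X) ∧ ∃ v ∈ fccSlots, e + A₂ v ∉ X)).card = 0 := by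
  rw [Finset.card_eq_zero, Finset.eq_empty_iff_forall_notMem]
  intro e he
  obtain ⟨heX, -, -, h11, ⟨hd₁, hf₁, -⟩, ⟨hd₂, hf₂, -⟩⟩ := mem_filter.1 he
  -- an eleventh neighbour off the ten star balls
  set N := X.filter fun q => dist e q = 1 with hN
  set S := ((fccSlots.filter fun w => 0 < ⟪w, -u₁⟫_ℝ).image fun w => e + A₁ w) ∪
      ((fccSlots.filter fun w => 0 < ⟪w, -u₂⟫_ℝ).image fun w => e + A₂ w) with hS
  have hS10 : S.card ≤ 10 := card_starBalls_le_ten A₁ A₂ hu₁ hu₂ e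
  have hne : (N \ S).Nonempty := by
    rw [← Finset.card_pos]
    have := Finset.le_card_sdiff S N
    omega
  obtain ⟨y, hy⟩ := hne
  rw [Finset.mem_sdiff] at hy
  obtain ⟨hyN, hyS⟩ := hy
  obtain ⟨hyX, hyd⟩ := mem_filter.1 hyN
  have off : ∀ (A : EuclideanSpace ℝ (Fin 3) ≃ₗᵢ[ℝ] EuclideanSpace ℝ (Fin 3)) (u : EuclideanSpace ℝ (Fin 3)),
      ((fccSlots.filter fun w => 0 < ⟪w, -u⟫_ℝ).image fun w => e + A w) ⊆ S →
      ∀ w ∈ fccSlots, ⟪w, u⟫_ℝ < 0 → y ≠ e + A w := by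
    intro A u hsub w hw hwu hyw
    apply hyS
    apply hsub
    exact Finset.mem_image.2 ⟨w, mem_filter.2 ⟨hw, by rw [inner_neg_right]; linarith⟩, hyw.symm⟩
  have hlin := hDS u₁ hu₁ u₂ hu₂ X hX e heX hd₁ hf₁ hd₂ hf₂ y hyX hyd
    (off A₁ u₁ subset_union_left) (off A₂ u₂ subset_union_right)
  exact hnc (coaxial_affine_of_linear A₁ A₂ t₁ t₂ hlin)

open scoped Classical in
/-- **Sealed chain ledger modulo `DoubleStarCoaxialAt`, crux hypotheses verbatim.**  See the module
docstring. -/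
theorem twoSlabAdhesion_sealed_of_doubleStarCoaxial
    {s₀ : EuclideanSpace ℝ (Fin 3)} (hs₀ : s₀ ∈ fccSlots)
    (hcert : ExactOnly 0 (fccSlots.filter fun w => 0 < ⟪w, s₀⟫_ℝ))
    (A₁ : EuclideanSpace ℝ (Fin 3) ≃ₗᵢ[ℝ] EuclideanSpace ℝ (Fin 3)) (t₁ : EuclideanSpace ℝ (Fin 3))
    (A₂ : EuclideanSpace ℝ (Fin 3) ≃ₗᵢ[ℝ] EuclideanSpace ℝ (Fin 3)) (t₂ : EuclideanSpace ℝ (Fin 3))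
    (hDS : DoubleStarCoaxialAt A₁ A₂)
    (hnc : ¬ ∃ (L : EuclideanSpace ℝ (Fin 3) ≃ₗᵢ[ℝ] EuclideanSpace ℝ (Fin 3))
        (s₁ s₂ : EuclideanSpace ℝ (Fin 3)) (σ σ' : ℤ → ℤ), IsHaggSeq σ ∧ IsHaggSeq σ' ∧
        (fun p => A₁ p + t₁) '' fccStacking 1 (Real.sqrt (2 / 3)) ⊆
          (fun p => L p + s₁) '' barlowStacking 1 (Real.sqrt (2 / 3)) σ ∧
        (fun p => A₂ p + t₂) '' fccStacking 1 (Real.sqrt (2 / 3)) ⊆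
          (fun p => L p + s₂) '' barlowStacking 1 (Real.sqrt (2 / 3)) σ')
    {u₁ : EuclideanSpace ℝ (Fin 3)} (hu₁ : u₁ ∈ fccSlots)
    (hsteep₁ : Real.sqrt 2 / 2 ≤ ⟪A₁ u₁, EuclideanSpace.single (2 : Fin 3) (1 : ℝ)⟫_ℝ)
    {u₂ : EuclideanSpace ℝ (Fin 3)} (hu₂ : u₂ ∈ fccSlots)
    (hsteep₂ : ⟪A₂ u₂, EuclideanSpace.single (2 : Fin 3) (1 : ℝ)⟫_ℝ ≤ -(Real.sqrt 2 / 2)) :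
    ∃ C R₀ : ℝ, 1 ≤ R₀ ∧ ∀ h : ℝ, 0 ≤ h → ∀ ρ : ℝ, R₀ ≤ ρ →
      ∀ X P₁ P₂ : Finset (EuclideanSpace ℝ (Fin 3)),
      (∀ p ∈ X, ∀ q ∈ X, p ≠ q → 1 ≤ dist p q) → P₁ ⊆ X → P₂ ⊆ X \ P₁ →
      (∀ p ∈ X, -(2 * R₀) ≤ p 2 ∧ p 2 ≤ h + 2 * R₀ ∧ p 0 ^ 2 + p 1 ^ 2 ≤ ρ ^ 2) →
      (∀ p, p ∈ P₁ ↔ (p ∈ (fun q => A₁ q + t₁) '' fccStacking 1 (Real.sqrt (2 / 3)) ∧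
        -(2 * R₀) ≤ p 2 ∧ p 2 ≤ -R₀ ∧ p 0 ^ 2 + p 1 ^ 2 ≤ ρ ^ 2)) →
      (∀ p, p ∈ P₂ ↔ (p ∈ (fun q => A₂ q + t₂) '' fccStacking 1 (Real.sqrt (2 / 3)) ∧
        h + R₀ ≤ p 2 ∧ p 2 ≤ h + 2 * R₀ ∧ p 0 ^ 2 + p 1 ^ 2 ≤ ρ ^ 2)) →
      ((((P₁ ×ˢ (X \ P₁)).filter fun pq => dist pq.1 pq.2 = 1).card : ℕ) : ℝ) +
        ((((P₂ ×ˢ ((X \ P₁) \ P₂)).filter fun pq => dist pq.1 pq.2 = 1).card : ℕ) : ℝ) ≤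
        contactDeficiency ((X \ P₁) \ P₂) +
          (Real.sqrt 2 / 4 * ∑ᶠ w ∈ {w ∈ fccStacking 1 (Real.sqrt (2 / 3)) | ‖w‖ = 1},
              |⟪w, A₁.symm (EuclideanSpace.single (2 : Fin 3) (1 : ℝ))⟫_ℝ| +
            Real.sqrt 2 / 4 * ∑ᶠ w ∈ {w ∈ fccStacking 1 (Real.sqrt (2 / 3)) | ‖w‖ = 1},
              |⟪w, A₂.symm (EuclideanSpace.single (2 : Fin 3) (1 : ℝ))⟫_ℝ| -
            (Real.sqrt 2 * |⟪A₁ u₁, EuclideanSpace.single (2 : Fin 3) (1 : ℝ)⟫_ℝ| +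
              Real.sqrt 2 * |⟪A₂ u₂, EuclideanSpace.single (2 : Fin 3) (1 : ℝ)⟫_ℝ|) / 2) * Real.pi * ρ ^ 2 +
          (((((X.filter fun e => e ∈ (fun q => A₁ q + t₁) '' fccStacking 1 (Real.sqrt (2 / 3)) ∧
                e - A₁ u₁ ∈ X ∧ (∀ w ∈ fccSlots, e - A₁ u₁ + A₁ w ∈ X) ∧
                ∃ v ∈ fccSlots, e + A₁ v ∉ X).filter fun e => ∃ n : EuclideanSpace ℝ (Fin 3), ‖n‖ = 1 ∧
              (∀ w ∈ fccSlots, ⟪A₁ w, n⟫_ℝ = 0 ∨ ⟪A₁ w, n⟫_ℝ = Real.sqrt (2 / 3) ∨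
                ⟪A₁ w, n⟫_ℝ = -Real.sqrt (2 / 3)) ∧
              ⟪A₁ u₁, n⟫_ℝ = Real.sqrt (2 / 3) ∧
              (∀ w ∈ fccSlots, ⟪A₁ w, n⟫_ℝ ≤ 0 → e + A₁ w ∈ X) ∧
              (∀ w ∈ fccSlots, 0 < ⟪A₁ w, n⟫_ℝ → e + A₁ w ∉ X ∧ e - A₁ w + (2 * ⟪A₁ w, n⟫_ℝ) • n ∈ X)).card
              : ℕ) : ℝ) +
           ((((X.filter fun e => e ∈ (fun q => A₂ q + t₂) '' fccStacking 1 (Real.sqrt (2 / 3)) ∧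
                e - A₂ u₂ ∈ X ∧ (∀ w ∈ fccSlots, e - A₂ u₂ + A₂ w ∈ X) ∧
                ∃ v ∈ fccSlots, e + A₂ v ∉ X).filter fun e => ∃ n : EuclideanSpace ℝ (Fin 3), ‖n‖ = 1 ∧
              (∀ w ∈ fccSlots, ⟪A₂ w, n⟫_ℝ = 0 ∨ ⟪A₂ w, n⟫_ℝ = Real.sqrt (2 / 3) ∨
                ⟪A₂ w, n⟫_ℝ = -Real.sqrt (2 / 3)) ∧
              ⟪A₂ u₂, n⟫_ℝ = Real.sqrt (2 / 3) ∧
              (∀ w ∈ fccSlots, ⟪A₂ w, n⟫_ℝ ≤ 0 → e + A₂ w ∈ X) ∧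
              (∀ w ∈ fccSlots, 0 < ⟪A₂ w, n⟫_ℝ → e + A₂ w ∉ X ∧ e - A₂ w + (2 * ⟪A₂ w, n⟫_ℝ) • n ∈ X)).card
              : ℕ) : ℝ)) / 2 +
          C * (1 + h) * ρ := by
  classical
  obtain ⟨hA₁₂, hA₂₁⟩ := slots_not_subset_of_not_coaxial A₁ t₁ A₂ t₂ hnc
  obtain ⟨C, R₀, hR₀, H⟩ := twoSlabAdhesion_chainLedger_sealed hs₀ hcert A₁ t₁ A₂ t₂ hA₁₂ hA₂₁ hu₁ hsteep₁
    hu₂ hsteep₂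
  refine ⟨C, R₀, hR₀, ?_⟩
  intro h hh ρ hρ X P₁ P₂ hX hP₁X hP₂X hcell hP₁ hP₂
  have key := H h hh ρ hρ X P₁ P₂ hX hP₁X hP₂X hcell hP₁ hP₂
  have hempty := dt11_card_eq_zero_of_doubleStarCoaxial A₁ A₂ hDS t₁ t₂ hnc hu₁ hu₂ hX
  rw [hempty] at key
  simpa using key

end Summit.Ventures.Crystal3D.Theorems

end
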